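import Mathlib.NumberTheory.Chebyshev
import Mathlib.NumberTheory.LSeries.RiemannZeta
import Mathlib.MeasureTheory.Integral.IntervalIntegral.Basic
import HarnessLib

/-!
# RH-CONDITIONAL / RH-FREE — Brent–Platt–Trudgian's explicit bounds for the mean square `∫_X^{2X} (ψ(x) − x)² dx` («nothing here bears on the truth of RH»)

Topic `Literature/NumberTheory/LFunctions` (RH literature-typing tranche 1, L4 "explicit zero
statistics", gen 2: the explicit constants of the mean-square consequence of the zero sums of
`ZetaZeroSumsLehmanExplicit.lean`). Labels: `BrentPlattTrudgian2022_thm1` is **RH-CONDITIONAL**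
as printed (`RiemannHypothesis → …`); `BrentPlattTrudgian2022_thm2` is **RH-FREE** as printed.
Published theorems vendored as NAMED FACTS (`def … : Prop`, D-0014; nothing asserted, users take
`(h : …)`). Nothing here bears on the truth of RH.

The tree PROVES the inexplicit forms: Montgomery–Vaughan Thm. 13.5 (RH → `∫_X^{2X}(ψ−x)² ≤ K X²`,
`Literature.NumberTheory.LFunctions.CramerMeanSquare.integral_sq_psi_sub_self_le_of_RH`,
`CramerMeanSquareRH.lean`) and Thm. 13.6 (the Cesàro limit `Σ m²/|ρ|²`, `CramerMeanSquareAsymptoticRH.lean`).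
The present source makes the constant explicit and settles the (non-)existence of the limit:

Source: R. P. Brent, D. J. Platt, T. S. Trudgian, *The mean square of the error term in the prime
number theorem*, J. Number Theory **238** (2022) 740–762 (arXiv:2008.06140)
`[corpus:paper:arxiv-2008.06140 p0003 (Thms. 1–2, (1.2))]`, with
`I(X) := ∫_X^{2X} (ψ(x) − x)² dx` ((1.2); `Literature.NumberTheory.LFunctions.pntErrorMeanSquare`):

* `BrentPlattTrudgian2022_thm1` — **Theorem 1**: "Assume the Riemann hypothesis and let `I(X)` be
  defined in (1.2). Then, for `X` sufficiently large we have `1/5374 ≤ I(X) X⁻² ≤ 0.8603`."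
  (The upper bound proves and improves Pintz's claim `c = 1`; it is `limsup I(X)/X² ≤ B ≤ 0.8603`
  with the pair sum `B` over zeros, (1.3) and Cor. 2. The source's §1 remarks that the LOWER
  bound is in fact unconditional — "the upper bound is conditional on RH whereas the lower bound is
  unconditional" — but Theorem 1 is printed under RH and is typed so.)
* `BrentPlattTrudgian2022_thm2` — **Theorem 2**: "With `I(X)` defined by (1.2), we have that
  `lim_{X→∞} I(X)/X²` does not exist." (Unconditional as printed: "If RH is false, then `I(X)/X²`
  is unbounded"; under RH from Thms. 4–5, `limsup 2J(X)/X² ≥ c₂`, `liminf ≤ c₁`.)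

`ψ = Chebyshev.psi` (Mathlib; the source's `ψ(x) = Σ_{n≤x} Λ(n)`). Deliberately NOT here: the pair
sum `B` ((1.3)) and its enclosure (Thm. 3, Cors. 2–3), `J(X) = ∫_0^X`, the constants `c₁, c₂` of
§5 and Thms. 4–5, and the zero-sum lemmas of §2 (typed in `ZetaZeroSumsLehmanExplicit.lean`).

## References

* R. P. Brent, D. J. Platt, T. S. Trudgian, J. Number Theory 238 (2022) 740–762, (1.2), Thms. 1–2.
  [BrentPlattTrudgian2022]
* H. L. Montgomery, R. C. Vaughan, *Multiplicative Number Theory I*, Thms. 13.5–13.6 (the inexplicit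
  forms, proved in the tree). [MontgomeryVaughan2007]
* H. Cramér, *Ein Mittelwertsatz in der Primzahltheorie*, Math. Z. 12 (1922) 147–153.
-/

noncomputable section

open Filter MeasureTheory
open scoped Real Chebyshev Topology

namespace Literature.NumberTheory.LFunctions

/-- `I(X) := ∫_X^{2X} (ψ(x) − x)² dx`, the dyadic mean square of the error term in the prime
number theorem (Brent–Platt–Trudgian (1.2); Montgomery–Vaughan Thm. 13.5), written exactly as the
tree's `CramerMeanSquare.integral_sq_psi_sub_self_le_of_RH` writes it (`∫ x in X..(2 * X), (ψ x − x)²`).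
[cite: BrentPlattTrudgian2022, eq. (1.2)] -/
def pntErrorMeanSquare (X : ℝ) : ℝ :=
  ∫ x in X..(2 * X), (ψ x - x) ^ 2

/-- Unfolding lemma. [cite: BrentPlattTrudgian2022, eq. (1.2)] -/
theorem pntErrorMeanSquare_def (X : ℝ) :
    pntErrorMeanSquare X = ∫ x in X..(2 * X), (ψ x - x) ^ 2 := rfl

/-- NAMED FACT, **RH-CONDITIONAL** as printed (**Brent–Platt–Trudgian 2022, Theorem 1**: "Assume
the Riemann hypothesis and let `I(X)` be defined in (1.2). Then, for `X` sufficiently large we have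
`1/5374 ≤ I(X)X⁻² ≤ 0.8603`."). Typed with Mathlib's `RiemannHypothesis` as antecedent and
"sufficiently large" as `∃ X₀, ∀ X ≥ X₀`. Users take `(h : BrentPlattTrudgian2022_thm1)` and feed
it RH; nothing here bears on the truth of RH. [cite: BrentPlattTrudgian2022, Thm. 1] -/
def BrentPlattTrudgian2022_thm1 : Prop :=
  RiemannHypothesis → ∃ X₀ : ℝ, ∀ X : ℝ, X₀ ≤ X →
    1 / 5374 ≤ pntErrorMeanSquare X / X ^ 2 ∧ pntErrorMeanSquare X / X ^ 2 ≤ 0.8603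

/-- NAMED FACT (**Brent–Platt–Trudgian 2022, Theorem 2**, as printed: "With `I(X)` defined by
(1.2), we have that `lim_{X→∞} I(X)/X²` does not exist."): there is no real `l` with
`I(X)/X² → l` as `X → ∞`. Unconditional as printed. Users take `(h : BrentPlattTrudgian2022_thm2)`.
[cite: BrentPlattTrudgian2022, Thm. 2] -/
def BrentPlattTrudgian2022_thm2 : Prop :=
  ¬ ∃ l : ℝ, Tendsto (fun X : ℝ ↦ pntErrorMeanSquare X / X ^ 2) atTop (𝓝 l)

/-! ## Elementary consequences (proved) -/

/-- Under RH, eventually `∫_X^{2X} (ψ − x)² ≤ 0.8603 X²` (the upper half of Theorem 1, cleared of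
the division). [cite: BrentPlattTrudgian2022, Thm. 1] -/
theorem BrentPlattTrudgian2022_thm1.eventually_le (h : BrentPlattTrudgian2022_thm1)
    (hRH : RiemannHypothesis) :
    ∃ X₀ : ℝ, ∀ X : ℝ, X₀ ≤ X → pntErrorMeanSquare X ≤ 0.8603 * X ^ 2 := by
  obtain ⟨X₀, hX⟩ := h hRH
  refine ⟨max X₀ 1, fun X hXle ↦ ?_⟩
  have hX1 : 1 ≤ X := (le_max_right _ _).trans hXle
  have hX0 : X₀ ≤ X := (le_max_left _ _).trans hXle
  have hsq : 0 < X ^ 2 := by positivity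
  have := (hX X hX0).2
  rwa [div_le_iff₀ hsq] at this

/-- Under RH, eventually `X²/5374 ≤ ∫_X^{2X} (ψ − x)²` (the lower half of Theorem 1).
[cite: BrentPlattTrudgian2022, Thm. 1] -/
theorem BrentPlattTrudgian2022_thm1.eventually_ge (h : BrentPlattTrudgian2022_thm1)
    (hRH : RiemannHypothesis) :
    ∃ X₀ : ℝ, ∀ X : ℝ, X₀ ≤ X → X ^ 2 / 5374 ≤ pntErrorMeanSquare X := by
  obtain ⟨X₀, hX⟩ := h hRH
  refine ⟨max X₀ 1, fun X hXle ↦ ?_⟩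
  have hX1 : 1 ≤ X := (le_max_right _ _).trans hXle
  have hX0 : X₀ ≤ X := (le_max_left _ _).trans hXle
  have hsq : 0 < X ^ 2 := by positivity
  have := (hX X hX0).1
  rw [le_div_iff₀ hsq] at this
  linarith

/-- Theorem 1 implies the Montgomery–Vaughan shape "eventually `I(X) ≤ K X²`" with the explicit
`K = 0.8603` (the tree proves the inexplicit `∃ K, ∀ X ≥ 2` unconditionally in `K`, see
`CramerMeanSquare.integral_sq_psi_sub_self_le_of_RH`). [cite: BrentPlattTrudgian2022, Thm. 1] -/
theorem BrentPlattTrudgian2022_thm1.isBigO (h : BrentPlattTrudgian2022_thm1) (hRH : RiemannHypothesis) :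
    Asymptotics.IsBigO atTop pntErrorMeanSquare fun X : ℝ ↦ X ^ 2 := by
  obtain ⟨X₀, hX⟩ := h.eventually_le hRH
  obtain ⟨X₁, hX₁⟩ := h.eventually_ge hRH
  refine Asymptotics.IsBigO.of_bound 0.8603 ?_
  rw [Filter.eventually_atTop]
  refine ⟨max X₀ X₁, fun X hXle ↦ ?_⟩
  have h1 := hX X ((le_max_left _ _).trans hXle)
  have h2 := hX₁ X ((le_max_right _ _).trans hXle)
  have hnn : 0 ≤ pntErrorMeanSquare X := le_trans (by positivity) h2
  rw [Real.norm_of_nonneg hnn, Real.norm_of_nonneg (by positivity)]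
  exact h1

end Literature.NumberTheory.LFunctions

end
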